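import Literature.Geometry.Lorentzian.RadiatedEnergy
import Literature.Geometry.Lorentzian.CutBondiMass
import Literature.Geometry.Lorentzian.BondiNewsFlux
import HarnessLib

/-!
# Null geometry of the leaves of a foliated null hypersurface and the flux of the Hawking mass
# (trunk G08 = T-LORENTZ; definition request `defn-NullHypersurface.hawkingFlux` of route
# FinalStateConjecture/PenroseDeficitNorm, items GainFreeConesSettle / KerrSaturatingConeMass)

For a compact spacelike `2`-surface `f : S → M` of a time-oriented Lorentzian `4`-manifold with a
null normal pair `P = (L, L̲)` (`NullNormalPair`: both legs future null normals, `g(L, L̲) = -2`,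
`TrappedSurface.lean`) the tree has the null second fundamental forms `χ_L`, the null expansions
`θ_L = tr_γ χ_L` (`nullSecondFundamentalForm`, `nullExpansion`), the Hawking mass
`m_H = √(|S|/16π)(1 + (16π)⁻¹ ∫ θ_L θ_L̲)` (`hawkingMass`, `BondiMass.lean`), the Gauss curvature
of the induced metric (`gaussCurvature`, `CutBondiMass.lean`), the squared shear
(`nullShearNormSq`, `BondiNewsFlux.lean`), Bondi foliations and parametrised null hypersurfaces
(`BondiFoliation`, `NullSheet`, `RadiatedEnergy.lean`). This file adds the remaining **leafwise
null geometry** and the **flux of the Hawking mass along a foliated null hypersurface**: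

* fibrewise/pointwise tools: the trace-free part of a bilinear form
  (`PseudoRiemannianMetric.traceFreePart`), the divergence of a vector field and of a `1`-form
  (`PseudoRiemannianMetric.divVector`, `.divCovector`, O'Neill's `div V = C(DV)`);
* for a surface with a null normal pair: the **shear** `χ̂_L` (`LorentzianMetric.nullShear`), the
  **torsion** `ζ(v) = ½ g(D_v L, L̲)` (`LorentzianMetric.torsion`, Christodoulou's (1.48)), its
  squared norm, and the **mass aspect function** `μ = K + ¼ θ_L θ_L̲ - div_γ ζ̲`
  (`LorentzianMetric.massAspect`; `ζ̲ = torsion P.swap = -ζ`, see *Conventions*);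
* the hypothesis structure `LorentzianMetric.NullHypersurface g τ` — a `NullSheet` (leaves
  `S_s = sec s`, generator `∂_s`) **with** the adapted null normal pair of every leaf, `L = ∂_s sec`
  (unit null lapse) — and on it: `area`, `areaRadius`, `expansion`/`expansionBar`, `shear`/`shearBar`,
  `shearNormSq`, `torsion`, `torsionNormSq`, `gaussCurvature`, `massAspect`, `hawkingMass`,
  `meanMassAspect` (`μ̄ = 2 m_H / r³`, `hawkingMass_eq_areaRadius_pow_mul`), the **Hawking flux
  density** `hawkingFluxDensity` `Φ` and the **Hawking flux** `hawkingFlux s = ∫_{S_s} Φ dA`, the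
  flux identity `d/ds m_H(S_s) = ∫_{S_s} Φ dA` as the predicates `HasHawkingFluxAt`,
  `HasHawkingFlux`, and the proved consequences `hawkingFluxDensity_nonneg` (sign of `Φ` on doubly
  convex constant-mass-aspect leaves under the null convergence / dominant energy conditions),
  `hawkingFlux_nonneg`, `hawkingMass_monotone`;
* gauge and convexity predicates on the foliation: `IsDoublyConvex` (`θ_L > 0 > θ_L̲`),
  `IsUniformlyExpanding`, `IsLuminosityFoliation` (Hawking's luminosity parameter, `θ_L = 2/s`),
  `IsConstantMassAspect` (`μ = μ̄`, Christodoulou–Klainerman, Sauter, Le), and Roesch's flux function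
  `roeschFlux` `ρ = 𝒦 - ¼⟨H⃗,H⃗⟩ + ∇̸·τ`, quasi-local mass `roeschMass`
  `m = ½((4π)⁻¹∫ρ^{2/3})^{3/2}` and `IsPFoliation` / `IsSPFoliation` (Roesch 2016, Defs. 1.3–1.5),
  with `leafLaplacian`;
* the bridge to Bondi foliations: `BondiFoliation.IsAdaptedCone u` and
  `BondiFoliation.coneNullHypersurface` (the cone `C⁺_u` with its sections as a `NullHypersurface`,
  `coneNullHypersurface_hawkingMass : hawkingMass = sectionHawkingMass u`), so that
  "`M_B(u) - m_H(S_{u,s})` small ⇒ weighted smallness of `(χ̂, ζ, μ - μ̄)` on late cones" can be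
  typed over one vocabulary.

No named facts are introduced: the flux identity is recorded as a predicate (`HasHawkingFlux`) whose
right-hand side is the explicit local density `Φ` of the sources; everything stated as a
`lemma`/`theorem` is proved.

## Conventions (read this before using `torsion` / `massAspect`)

Throughout, `(L, L̲)` is the tree's `NullNormalPair`: both future-directed, `g(L, L̲) = -2`, and on a
`NullHypersurface` `L = ∂_s sec` is the generator, `L̲` the transversal null normal of the leaves;
`χ_L(v,w) = g(D_v L, df w)` (sign convention (h)), `θ = tr_γ χ`, so that for the outgoing cones of
an asymptotically flat region `θ_L > 0 > θ_L̲` and `⟨H⃗, H⃗⟩ = -θ_L θ_L̲ > 0`.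

* **Torsion.** `torsion P (v) = ζ(v) = ½ g(D_v L, L̲)` is Christodoulou's torsion of `S` *with
  respect to the null hypersurface generated by `L`* (*The formation of black holes*,
  arXiv:0805.3880, (1.48)); `torsion P.swap = ζ̲ = -ζ` (ibid. (1.49)). Roesch (arXiv:1609.02875,
  Def. 1.1 and §3.1), Alexakis (arXiv:1506.06400, §2.2), Le (arXiv:2404.17137, Def. 6.1) and
  Mars–Soria (arXiv:1511.06242, §2, `s_ℓ`) normalise the transversal normal `L'` of the generator
  by `g(L, L') = +2` (Roesch, Alexakis, Le; `L' = -L̲`) resp. `-2` (Mars–Soria; `ℓ = L̲`); their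
  torsions are `½ g(D L, L') = ζ̲` resp. `s_ℓ = ζ`. Boost: `(L, L̲) ↦ (aL, a⁻¹L̲)` gives
  `ζ ↦ ζ - d log a`.
* **Mass aspect function.** `massAspect P = μ = K + ¼ θ_L θ_L̲ - div_γ ζ̲ = K + ¼ θ_L θ_L̲ + div_γ ζ`.
  This is the function printed as `μ = 𝒦 - ¼⟨H⃗,H⃗⟩ - ∇̸·ζ` by Roesch (§1.1, "first introduced by
  Christodoulou"), `μ = K - ¼ tr χ tr χ̲ - div ζ` by Alexakis ((maspect), with
  `∫_𝒮 μ = 8π m_Hawk / r`) and `ᵘμ̄ = K - ¼ tr χ' tr χ - div̸ η̄` by Le (Def. 6.1) — their `ζ`, `η̄`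
  being `ζ̲` — and it coincides with `μ̲ = K + ¼ tr χ tr χ̲ - div̸ η̲` of Christodoulou 2008,
  (6.95) (`η̲ = -ζ + d̸ log Ω`) for lapse `Ω ≡ 1`. It is *the* mass aspect function governing the
  Hawking mass along the hypersurface generated by `L`: from the first variation of area
  `∂_s dA = θ_L dA`, the Raychaudhuri equation `L θ_L = -½θ_L² - |χ̂_L|² - Ric(L,L) + κ θ_L` and
  the transport equation `L θ_L̲ = G(L,L̲) - 2K - θ_L θ_L̲ - 2 div ζ + 2|ζ|² - κ θ_L̲`
  (Mars–Soria 2016, §2, the equations before Lemma 1 with `φ = 2`; Roesch 2016, Prop. 3.1, (11),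
  (13); Christodoulou 2008, (2.139); Gourgoulhon–Jaramillo) one gets
  `∂_s (θ_L θ_L̲ dA) = (-2θ_L μ + 2θ_L|ζ|² - θ_L̲|χ̂_L|² - θ_L̲ Ric(L,L) + θ_L G(L,L̲)) dA`, whence the
  flux density `Φ` of `hawkingFluxDensity` (Sauter 2008, Thm. 4.1, as reported by Roesch §2.3 and
  Alexakis §4.2; vacuum special cases printed in Alexakis, Lemma 19, and Le, (6.7):
  `L̄ μ̄ᵘ = -³⁄₂ μ̄ᵘ \overline{tr χ̄} + ¼ \overline{tr χ̄'|χ̂̄|²} + ½ \overline{tr χ̄ |η̄|²}`, which is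
  the present identity for `m_H = ½ r³ μ̄` in Le's normalisation `tr χ̄' = -θ_L̲`).
* **Mean mass aspect.** `meanMassAspect s = μ̄_s := (4π/|S_s|)(1 + (16π)⁻¹∫θ_Lθ_L̲) = 2 m_H / r³` is
  *defined* through the Hawking mass; it is the leaf average of `μ` exactly when `∫_{S_s} K = 4π`
  (spherical leaves, Gauss–Bonnet) since `∫ div ζ̲ = 0` — neither theorem being available, this is
  documentation, and the flux identity holds with this `μ̄` for leaves of any topology.

## Mathlib

No Lorentzian geometry, null hypersurfaces, Hawking mass or mass aspect function in Mathlib (at the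
pin). Used: `LinearMap.trace`, `Module.finBasis`/`Module.Basis.constr` (honest-linearity device of
`Hypersurface.lean`), `Real.sqrt`, `Real.rpow`, `HasDerivAt`, `monotone_of_deriv_nonneg`, the
Bochner integral and `integral_nonneg`; from the project the modules listed above, the Levi-Civita
API (`leviCivita`, `ricci`, `einsteinTensor`, `dalembertian`, `sharp`, `trace`, `normSq`,
`innerDual`) with its discharged standing hypothesis `hasLeviCivita` (`LeviCivitaProofs.lean`).

## Design choices

* *Adapted pair, unit lapse.* `NullHypersurface` extends `NullSheet` by the pair fields `pair`,
  `pair_L : (pair s).L = ∂_s sec` rather than by a lapse function: every foliation of a null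
  hypersurface by the level sets of a parameter `s` has a unique generator field with `L(s) = 1`
  (Roesch 2016, §3.1; Mars–Soria 2016, §2; Alexakis 2015, Def. 18; Le 2024, Def. 6.1), and all
  printed flux formulas with a lapse `a` are the unit-lapse formulas for the pair `(aL, a⁻¹L̲)`.
* *Honest linearity of the torsion* via `Module.finBasis`, exactly as for `secondFundamentalForm`;
  no `_apply` fact is vendored (D-0026), agreement with `½ g(D_v L, L̲)` for all `v` holding for `C¹`
  pairs at interior points by linearity of `v ↦ D_v L`.
* *Standing hypotheses.* The leaf-level definitions take `hpb` (smoothness of pullbacks) like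
  `hawkingMass`; the Gauss curvature enters through `gaussCurvature` of `CutBondiMass.lean`, which
  feeds the discharged fact `contMDiff_pullbackBilin_holds` — the same induced metric by proof
  irrelevance. The Levi-Civita hypotheses of `g` and of the leaf metrics are discharged inside the
  definitions (`hasLeviCivita`), as in `CutBondiMass.lean`.
* *What is not formalised.* The flux identity itself (first/second variation along the generator,
  Gauss–Bonnet and the divergence theorem on the leaves, differentiation under the integral): it is
  the predicate `HasHawkingFlux`, to be assumed by statements that need it (e.g. as a crux), with the
  explicit density `Φ`; likewise Roesch's monotonicity theorem for `roeschMass` on (P)-foliations is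
  only cited. The equality `ζ̲ = -ζ` (metric compatibility) and `|nullShear|²_γ = nullShearNormSq`
  (polarisation) are documented, not proved.
* *Junk values.* `meanMassAspect` divides by the area (junk for `|S_s| = 0`); `roeschFlux` takes
  `log θ_L` and `roeschMass` real powers of `ρ` (meant for `θ_L > 0`, `ρ > 0`, Roesch's standing
  assumptions "expanding along the generator", `|ρ| > 0`); Bochner integrals of non-integrable
  densities are `0`.

## References

* J. Sauter, *Foliations of null hypersurfaces and the Penrose inequality*, Diss. ETH 17842 (2008),
  doi:10.3929/ethz-a-005713669, §4 and Thm. 4.1 (variation of the Hawking mass along null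
  foliations, constant mass aspect foliations). Not held (acquisition requests acq-03424,
  acq-03442); its definitions and Thm. 4.1 are used through their restatements in Roesch 2016
  (Def. 1.1 "following the conventions of Sauter", §2.3 "[S] Theorem 4.1", §3) and Alexakis 2015
  (§4.2, "The proof of this follows [Sauter], which elaborates the argument in [H]").
* H. Roesch, *Proof of a null Penrose conjecture using a new quasi-local mass*, arXiv:1609.02875,
  Comm. Anal. Geom. 29 (2021): Defs. 1.1–1.5, Thm. 1.1, §2.3 (Cor. 1), §3.1, Prop. 3.1.
* S. Alexakis, *The Penrose inequality on perturbations of the Schwarzschild exterior*,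
  arXiv:1506.06400: §2.2 (Ricci coefficients, `ζ`, `μ`, `∫μ = 8πm/r`), Def. 18 (luminosity
  foliations), Lemma 19 (monotonicity of the Hawking mass).
* M. Mars, A. Soria, *On the Penrose inequality along null hypersurfaces*, arXiv:1511.06242,
  Class. Quantum Grav. 33 (2016) 115019: §2 (null flows with `k(μ) = -1`, `⟨k, ℓ^φ⟩ = -φ`, `s_ℓ`,
  the evolution equations for `γ`, `θ_k`, `θ_ℓ`, Lemma 1).
* P. Le, *Global existence and geometry of constant mass aspect function foliation in perturbed
  Schwarzschild spacetime*, arXiv:2404.17137: Def. 6.1 (mass aspect function of a foliation),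
  Def. 6.2 (constant mass aspect function foliation, area-radius parametrisation), (6.7)–(6.9).
* D. Christodoulou, *The formation of black holes in general relativity*, EMS 2009 = arXiv:0805.3880:
  (1.48)–(1.49) (torsion `ζ`, `ζ̲ = -ζ`), (2.139) (`D(Ω tr χ̲)`), (6.94)–(6.95) (mass aspect
  functions `μ`, `μ̲`).
* D. Christodoulou, S. Klainerman, *The global nonlinear stability of the Minkowski space*,
  Princeton 1993, Ch. 17 ((17.0.2) Hawking mass, (17.0.7)).
* S. W. Hawking, *Gravitational radiation in an expanding universe*, J. Math. Phys. 9 (1968) 598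
  (Hawking mass, luminosity parameter, monotonicity along outgoing null cones).
* B. O'Neill, *Semi-Riemannian geometry*, Academic Press 1983, Ch. 3, p. 86 (divergence
  `div V = C(DV)`), Def. 3.50 (Laplacian).
-/

noncomputable section

open Bundle Set Manifold TopologicalSpace Filter MeasureTheory Real
open scoped ContDiff Topology ENNReal

namespace Literature.Geometry.Lorentzian

/-! ### Fibrewise linear algebra: trace-free part of a bilinear form -/

namespace PseudoRiemannianMetric

section TraceFree

variable
  {EB : Type*} [NormedAddCommGroup EB] [NormedSpace ℝ EB]
  {HB : Type*} [TopologicalSpace HB] {IB : ModelWithCorners ℝ EB HB} {n : ℕ∞ω}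
  {B : Type*} [TopologicalSpace B] [ChartedSpace HB B]
  {F : Type*} [NormedAddCommGroup F] [NormedSpace ℝ F]
  {E : B → Type*} [TopologicalSpace (TotalSpace F E)]
  [∀ b, TopologicalSpace (E b)] [∀ b, AddCommGroup (E b)] [∀ b, Module ℝ (E b)]
  [FiberBundle F E] [VectorBundle ℝ F E] [FiniteDimensional ℝ F]

/-- The **trace-free part** `T̂ = T - (tr_g T / rank) g_b` of a bilinear form `T` on the fibre at
`b` with respect to the metric `g` (`rank = dim F` the fibre dimension; for `2`-dimensional fibres,
`T̂ = T - ½ (tr_γ T) γ`). Roesch 2016 (arXiv:1609.02875), Def. 1.1 ("for a symmetric `2`-tensor `T`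
on `Σ` its trace-free part is `T̂ := T - ½ (tr_γ T) γ`"); Alexakis,
arXiv:1506.06400, §2.2 (`χ̂ = χ - ½ (tr χ) γ̸`). [cite: Roesch2016, Def. 1.1] -/
def traceFreePart (g : PseudoRiemannianMetric IB n F E) (b : B) (T : LinearMap.BilinForm ℝ (E b)) :
    LinearMap.BilinForm ℝ (E b) :=
  T - (g.trace b T / (Module.finrank ℝ F : ℝ)) • g.toBilinForm b

/-- Unfolding lemma: `T̂(v, w) = T(v, w) - (tr_g T / rank) g_b(v, w)`. [folklore] -/
@[simp]
lemma traceFreePart_apply (g : PseudoRiemannianMetric IB n F E) (b : B)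
    (T : LinearMap.BilinForm ℝ (E b)) (v w : E b) :
    g.traceFreePart b T v w = T v w - g.trace b T / (Module.finrank ℝ F : ℝ) * g.val b v w := by
  simp [traceFreePart]

/-- The metric trace is linear in the bilinear form. [folklore] -/
lemma trace_sub_smul (g : PseudoRiemannianMetric IB n F E) (b : B)
    (T T' : LinearMap.BilinForm ℝ (E b)) (c : ℝ) :
    g.trace b (T - c • T') = g.trace b T - c * g.trace b T' := by
  simp only [trace, LinearMap.comp_sub, LinearMap.comp_smul, map_sub, map_smul, smul_eq_mul]

/-- The trace-free part is trace-free: `tr_g T̂ = 0` (given the value `tr_g g = rank` of the named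
fact `trace_toBilinForm`, hypothesis `h`, and a positive-dimensional fibre). Roesch 2016, Def. 1.1.
[cite: Roesch2016, Def. 1.1] -/
lemma trace_traceFreePart (h : trace_toBilinForm (IB := IB) (n := n) (F := F) (E := E))
    (hF : 0 < Module.finrank ℝ F) (g : PseudoRiemannianMetric IB n F E) (b : B)
    (T : LinearMap.BilinForm ℝ (E b)) : g.trace b (g.traceFreePart b T) = 0 := by
  have hF' : (Module.finrank ℝ F : ℝ) ≠ 0 := by exact_mod_cast hF.ne'
  rw [traceFreePart, trace_sub_smul, h g b, div_mul_cancel₀ _ hF', sub_self]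

/-- A trace-free form is its own trace-free part. [folklore] -/
lemma traceFreePart_eq_self_of_trace_eq_zero (g : PseudoRiemannianMetric IB n F E) (b : B)
    {T : LinearMap.BilinForm ℝ (E b)} (hT : g.trace b T = 0) : g.traceFreePart b T = T := by
  refine LinearMap.ext₂ fun v w ↦ ?_
  simp [traceFreePart_apply, hT]

end TraceFree

/-! ### Divergence of vector fields and of `1`-forms -/

section Divergence

variable {E : Type*} [NormedAddCommGroup E] [NormedSpace ℝ E] {H : Type*} [TopologicalSpace H]
  {I : ModelWithCorners ℝ E H} {M : Type*} [TopologicalSpace M] [ChartedSpace H M]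
  [IsManifold I ∞ M] {n : ℕ∞ω}
  (g : PseudoRiemannianMetric I n E (TangentSpace I : M → Type _))
  [FiniteDimensional ℝ E] [CompleteSpace E] [Fact (1 ≤ n)] [g.HasLeviCivita]

/-- The **divergence of a vector field** `Z` at `x`: `div Z (x) = C(∇Z)_x = tr (X₀ ↦ ∇_{X₀} Z)`,
the contraction of the covariant differential of `Z` (for the Levi-Civita connection of `g`;
Mathlib's argument order `g.leviCivita Z x X₀ = ∇_{X₀} Z`), `= Σ εᵢ g(∇_{Eᵢ} Z, Eᵢ)` in an
orthonormal frame. Junk value inherited from `leviCivita` at points where `Z` is not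
differentiable. O'Neill 1983, Ch. 3, p. 86 (`div V = C(DV)`). [cite: ONeill1983, Ch. 3, p. 86] -/
def divVector (Z : Π x : M, TangentSpace I x) (x : M) : ℝ :=
  LinearMap.trace ℝ (TangentSpace I x) (g.leviCivita Z x).toLinearMap

/-- The **divergence of a `1`-form** `θ` at `x`: `div θ := div (θ^♯) = g^{ij} ∇_i θ_j`, the
divergence of the metrically equivalent vector field `♯θ` (the covariant differential commutes
with type-changing, O'Neill 1983, Ch. 3, p. 86; for `θ = df` this is the Laplacian
`Δ f = div grad f`, Def. 3.50). This is the operator `∇̸ · ζ` applied to the torsion `1`-form in the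
mass aspect function. [cite: ONeill1983, Ch. 3, p. 86] -/
def divCovector (θ : Π x : M, TangentSpace I x →ₗ[ℝ] ℝ) (x : M) : ℝ :=
  g.divVector (fun y ↦ g.sharp y (θ y)) x

omit [CompleteSpace E] [Fact (1 ≤ n)] in
/-- Unfolding lemma for the divergence of a `1`-form. [folklore] -/
lemma divCovector_eq (θ : Π x : M, TangentSpace I x →ₗ[ℝ] ℝ) (x : M) :
    g.divCovector θ x = g.divVector (fun y ↦ g.sharp y (θ y)) x :=
  rfl

end Divergence

end PseudoRiemannianMetric

/-! ### Leafwise null geometry of a spacelike surface with a null normal pair -/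

namespace LorentzianMetric

section Leaf

variable {E : Type*} [NormedAddCommGroup E] [NormedSpace ℝ E] {H : Type*} [TopologicalSpace H]
  {I : ModelWithCorners ℝ E H} {M : Type*} [TopologicalSpace M] [ChartedSpace H M]
  {E'' : Type*} [NormedAddCommGroup E''] [NormedSpace ℝ E''] {H'' : Type*} [TopologicalSpace H'']
  {I'' : ModelWithCorners ℝ E'' H''} {S : Type*} [TopologicalSpace S] [ChartedSpace H'' S]
  [IsManifold I ∞ M] {n : ℕ∞ω}
  [FiniteDimensional ℝ E] [CompleteSpace E] [Fact (1 ≤ n)] [FiniteDimensional ℝ E'']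
  [IsManifold I'' ∞ S]
  (g : LorentzianMetric I n M) [g.HasLeviCivita] {τ : TimeOrientation g} (f : S → M)

variable (I'') in
/-- The **null shear** `χ̂_L = χ_L - ½ (tr_γ χ_L) γ` of the spacelike immersion `f : S → M` with
respect to the field `L` along `f` (meant: a null normal): the trace-free part, with respect to the
induced metric `γ = f^* g`, of the null second fundamental form `χ_L(v, w) = g(D_v L, df w)`
(`nullSecondFundamentalForm`, sign convention (h)); `½ = 1 / dim S` for surfaces. Roesch 2016,
Def. 1.1 (`χ = χ̂ + ½ (tr χ) γ`, "shear and expansion components");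
Alexakis, arXiv:1506.06400, §2.2; Christodoulou–Klainerman 1993, Ch. 17 (`χ̂`, `η̂`). Hypothesis
`hpb` as for `inducedMetric`. [cite: Roesch2016, Def. 1.1] -/
def nullShear (hpb : PseudoRiemannianMetric.contMDiff_pullbackBilin I M I'' S n)
    (hf : g.IsSpacelikeImmersion I'' f) (L : NormalField I f) (y : S) :
    LinearMap.BilinForm ℝ (TangentSpace I'' y) :=
  (g.inducedMetric f hpb hf).traceFreePart y (g.nullSecondFundamentalForm I'' f L y)

omit [CompleteSpace E] [Fact (1 ≤ n)] in
/-- `χ̂_L(v, w) = χ_L(v, w) - (θ_L / dim S) γ(v, w)` with `θ_L` the null expansion. Roesch 2016,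
Def. 1.1. [cite: Roesch2016, Def. 1.1] -/
lemma nullShear_apply (hpb : PseudoRiemannianMetric.contMDiff_pullbackBilin I M I'' S n)
    (hf : g.IsSpacelikeImmersion I'' f) (L : NormalField I f) (y : S)
    (v w : TangentSpace I'' y) :
    g.nullShear I'' f hpb hf L y v w =
      g.nullSecondFundamentalForm I'' f L y v w -
        g.nullExpansion f hpb hf L y / (Module.finrank ℝ E'' : ℝ) *
          g.inducedBilin I'' f y v w := by
  simp [nullShear, nullExpansion, PseudoRiemannianMetric.traceFreePart_apply]

/-- The **torsion** `1`-form `ζ = ζ_{(L, L̲)}` of `f : S → M` with respect to the null normal pair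
`P = (L, L̲)` (`g(L, L̲) = -2`), at `y : S`: the linear form on `T_y S` with
`ζ(v) = ½ g_{f y}(D_v L, L̲)`, `D_v L` the covariant derivative of `L` along `f` in the direction
`v` (`normalDerivAlong`). To be honestly linear it is defined — exactly as `secondFundamentalForm`
— as the unique linear form agreeing with `v ↦ ½ g(D_v L, L̲)` on the canonical basis
`Module.finBasis ℝ (T_y S)` (`Module.Basis.constr`); for `C¹` null normals at interior points the
two agree for all `v`. This is Christodoulou's torsion of `S` *with respect to the null
hypersurface generated by `L`* (*The formation of black holes*, (1.48):
`ζ(X) = ½ g(∇_X L̂, L̲̂)`); the torsion with respect to the swapped pair is `ζ̲ = ζ_{(L̲, L)} = -ζ`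
(ibid. (1.49)), and Roesch 2016 (Def. 1.1), Alexakis (arXiv:1506.06400, §2.2) and Le
(arXiv:2404.17137, Def. 6.1) — who normalise the transversal null normal `L'` of the generator `L`
by `g(L, L') = +2`, i.e. `L' = -L̲` — use `V ↦ ½ g(D_V L, L') = -ζ(V) = ζ̲(V)`. Under the boost
`(L, L̲) ↦ (a L, a⁻¹ L̲)`, `ζ ↦ ζ - d log a`. [cite: Christodoulou2008, (1.48)] -/
def torsion (P : NullNormalPair I'' g τ f) (y : S) : TangentSpace I'' y →ₗ[ℝ] ℝ :=
  haveI : FiniteDimensional ℝ (TangentSpace I'' y) := inferInstanceAs (FiniteDimensional ℝ E'')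
  (Module.finBasis ℝ (TangentSpace I'' y)).constr ℝ fun i ↦
    (1 / 2 : ℝ) * g.val (f y) (g.normalDerivAlong f P.L y (Module.finBasis ℝ (TangentSpace I'' y) i))
      (P.Lbar y)

omit [CompleteSpace E] [Fact (1 ≤ n)] [IsManifold I'' ∞ S] in
/-- On the canonical basis `bᵢ` of `T_y S`, `ζ(bᵢ) = ½ g(D_{bᵢ} L, L̲)` by construction.
Christodoulou 2008, (1.48). [cite: Christodoulou2008, (1.48)] -/
lemma torsion_apply_basis (P : NullNormalPair I'' g τ f) (y : S)
    (i : Fin (Module.finrank ℝ (TangentSpace I'' y))) :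
    haveI : FiniteDimensional ℝ (TangentSpace I'' y) := inferInstanceAs (FiniteDimensional ℝ E'')
    g.torsion f P y (Module.finBasis ℝ (TangentSpace I'' y) i) =
      (1 / 2 : ℝ) * g.val (f y)
        (g.normalDerivAlong f P.L y (Module.finBasis ℝ (TangentSpace I'' y) i)) (P.Lbar y) := by
  simp only [torsion, Module.Basis.constr_basis]

variable [CompleteSpace E'']

/-- The **mass aspect function** `μ` of the compact spacelike surface `f : S → M` with respect to
the null normal pair `P = (L, L̲)`, `L` meant to be the generator of the null hypersurface along
which `S` is moved:

  `μ = K + ¼ θ_L θ_L̲ - div_γ ζ̲`,   `ζ̲ = ζ_{(L̲, L)} = torsion P.swap` (`= -ζ_{(L, L̲)}`),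

`K` the Gauss curvature of the induced metric `γ = f^* g` (`gaussCurvature`), `θ_L`, `θ_L̲` the null
expansions (`nullExpansion`; `¼ θ_L θ_L̲ = -¼ ⟨H⃗, H⃗⟩` with the normalisation `g(L, L̲) = -2`) and
`div_γ` the divergence of a `1`-form on `(S, γ)` (`divCovector` for the Levi-Civita connection of
`γ`). This is *the* function with `∫_S μ dA = 4π χ_E(S)/2 + ¼ ∫ θ_L θ_L̲` — so that for a
`2`-sphere `m_H(S) = (r/8π) ∫_S μ dA = ½ r³ μ̄`, `r = √(|S|/4π)` (Gauss–Bonnet and the divergence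
theorem) — which governs the variation of the Hawking mass along the null hypersurface generated
by `L` (`NullHypersurface.hawkingFluxDensity`). **Dictionary.** Roesch 2016 (arXiv:1609.02875),
§1.1 ("the mass aspect function `μ = 𝒦 - ¼⟨H⃗,H⃗⟩ - ∇̸·ζ`, first introduced by Christodoulou"),
Alexakis, arXiv:1506.06400, §2.2 (`μ = K - ¼ tr χ tr χ̲ - div ζ`, `∫_S μ = 8π m_Hawk / r`) and
Le, arXiv:2404.17137, Def. 6.1, all write `-div` of *their* torsion, which is taken with the
transversal normal `L' = -L̲` of the generator (`g(L, L') = +2`) and therefore equals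
`ζ̲ = -ζ_{(L,L̲)}` in the present normalisation (see `torsion`); and for lapse `Ω ≡ 1` it coincides
with the function `μ̲ = K + ¼ tr χ tr χ̲ - div̸ η̲` (`η̲ = -ζ + d̸ log Ω`) of Christodoulou, *The
formation of black holes*, (6.95). In terms of `ζ = torsion P` itself, `μ = K + ¼ θ_L θ_L̲ + div_γ ζ`. Under the boost
`(L, L̲) ↦ (a L, a⁻¹ L̲)`, `μ ↦ μ - Δ_γ log a`. Hypothesis `hpb` as for `hawkingMass`.
[cite: Roesch2016, §1.1 (mass aspect function)] [cite: Alexakis2015, §2.2 (maspect)] -/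
def massAspect (hpb : PseudoRiemannianMetric.contMDiff_pullbackBilin I M I'' S n)
    (hf : g.IsSpacelikeImmersion I'' f) (P : NullNormalPair I'' g τ f) (y : S) : ℝ :=
  haveI := (g.inducedMetric f hpb hf).hasLeviCivita
  g.gaussCurvature f hf y +
    (1 / 4 : ℝ) * (g.nullExpansion f hpb hf P.L y * g.nullExpansion f hpb hf P.Lbar y) -
      (g.inducedMetric f hpb hf).divCovector (g.torsion f P.swap) y

/-- The squared `γ`-norm `|ζ|²_γ = γ^{AB} ζ_A ζ_B` of the torsion of `P` at `y` (`innerDual` of the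
induced metric). Alexakis, arXiv:1506.06400, Lemma 19 (`|ζ|²`); Christodoulou 2008, (2.139)
(`|η̲|²_γ̸`). [cite: Alexakis2015, Lemma 19] -/
def torsionNormSq (hpb : PseudoRiemannianMetric.contMDiff_pullbackBilin I M I'' S n)
    (hf : g.IsSpacelikeImmersion I'' f) (P : NullNormalPair I'' g τ f) (y : S) : ℝ :=
  (g.inducedMetric f hpb hf).innerDual y (g.torsion f P y) (g.torsion f P y)

omit [CompleteSpace E] [Fact (1 ≤ n)] [CompleteSpace E''] in
/-- `|ζ|²_γ ≥ 0`: the induced metric `γ` is Riemannian and `γ⁻¹(α, α) = γ(♯α, ♯α)` (cf.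
`PseudoRiemannianMetric.innerDual_self_nonneg` of `DalembertianCompose.lean`). [folklore] -/
lemma torsionNormSq_nonneg (hpb : PseudoRiemannianMetric.contMDiff_pullbackBilin I M I'' S n)
    (hf : g.IsSpacelikeImmersion I'' f) (P : NullNormalPair I'' g τ f) (y : S) :
    0 ≤ g.torsionNormSq f hpb hf P y := by
  rw [torsionNormSq, PseudoRiemannianMetric.innerDual_eq_val_sharp_sharp]
  by_cases hα : (g.inducedMetric f hpb hf).sharp y (g.torsion f P y) = 0
  · simp [hα]
  · exact (g.isRiemannian_inducedMetric f hpb hf y _ hα).le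

end Leaf

/-! ### Foliated null hypersurfaces with adapted null normal pair -/

section Sheet

variable {E : Type*} [NormedAddCommGroup E] [NormedSpace ℝ E] {H : Type*} [TopologicalSpace H]
  {I : ModelWithCorners ℝ E H} {M : Type*} [TopologicalSpace M] [ChartedSpace H M]
  [IsManifold I ∞ M] [FiniteDimensional ℝ E] [CompleteSpace E]

/-- Hypothesis structure: a **foliated null hypersurface with its adapted null normal pair** of
the time-oriented Lorentzian `4`-manifold `(M, g, τ)` — a parametrised null hypersurface
`(s, y) ↦ S_s(y)` (`NullSheet`: compact smoothly embedded spacelike sections `S_s = sec s`, swept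
injectively, generator curves `s ↦ sec s y` differentiable with velocity `∂_s` null,
future-directed and `g`-orthogonal to `S_s`) **together with** a null normal pair
`pair s = (L, L̲)` of every leaf (`g(L, L̲) = -2`, both future null normals, `C¹`) whose first leg
**is the generator**, `L = ∂_s sec` (`pair_L`). Thus `L` is normalised by `L(s) = 1` (unit null
lapse: Roesch 2016, §3.1, "`L̲(s) = 1`"; Mars–Soria 2016, §2, "`k(μ) = -1`"; Alexakis 2015,
Def. 18, "`L̲ s = 1`"; Le 2024, Def. 6.1, "`L̄ᵘ u = 1`") and `L̲` is the transversal future null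
normal of the leaves; a general null lapse `a > 0` corresponds to the reparametrised foliation
data `(a L, a⁻¹ L̲)`, which is again of this form for the parameter it defines, so no generality
is lost. All leafwise null geometry below (expansions, shears, torsion, mass aspect function,
Hawking mass and its flux) refers to this adapted pair. The cones `C⁺_u` of a Bondi foliation
(`BondiFoliation`, `RadiatedEnergy.lean`) carry such a structure as soon as their sections depend
differentiably on `s` with `∂_s sec = L` (`BondiFoliation.IsAdaptedCone`,
`BondiFoliation.coneNullHypersurface`). [cite: Roesch2016, §3.1 (setup)] -/
structure NullHypersurface (g : LorentzianMetric I ∞ M) (τ : TimeOrientation g)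
    extends NullSheet g τ where
  /-- The null normal pair `(L, L̲)` of the leaf `S_s`, `L` the generator. -/
  pair (s : ℝ) : NullNormalPair (𝓡 2) g τ (sec s)
  /-- The first leg of the pair is the generator `∂_s sec` (unit null lapse). -/
  pair_L (s : ℝ) (y : surf) : (pair s).L y = velocity I (fun s' ↦ sec s' y) s

namespace NullHypersurface

variable {g : LorentzianMetric I ∞ M} {τ : TimeOrientation g} (𝒩 : g.NullHypersurface τ)

omit [FiniteDimensional ℝ E] [CompleteSpace E] in
/-- The first leg of the adapted pair is the generator of the underlying null sheet. [folklore] -/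
lemma pair_L_eq_generator (s : ℝ) (y : 𝒩.surf) :
    (𝒩.pair s).L y = 𝒩.toNullSheet.generator s y :=
  𝒩.pair_L s y

/-- The **induced (Riemannian) metric** `γ_s = sec s^* g` of the leaf `S_s`, as a pseudo-Riemannian
metric (so that traces, `♯`, its Levi-Civita connection and curvature apply). [folklore] -/
def leafMetric (s : ℝ) :
    PseudoRiemannianMetric (𝓡 2) ∞ (EuclideanSpace ℝ (Fin 2)) (TangentSpace (𝓡 2) : 𝒩.surf → _) :=
  g.inducedMetric (𝒩.sec s) 𝒩.hpb (𝒩.isSpacelike s)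

/-- The **area** `|S_s|` of the leaf `S_s` (`totalArea` of the induced Riemannian metric, as in
`NullSheet.sectionMeasure` and `BondiFoliation.tendsto_area`). [folklore] -/
def area (s : ℝ) : ℝ≥0∞ :=
  totalArea (g.inducedRiemannianMetric (𝒩.sec s) 𝒩.hpb (𝒩.isSpacelike s))

/-- The **area radius** `r_s = √(|S_s| / 4π)` of the leaf `S_s`. Christodoulou–Klainerman 1993,
Ch. 17, (17.0.2); Alexakis 2015, §2.2 (`r[𝒮] = √(Area[𝒮]/4π)`). [cite: Alexakis2015, §2.2] -/
def areaRadius (s : ℝ) : ℝ :=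
  √((𝒩.area s).toReal / (4 * π))

omit [FiniteDimensional ℝ E] [CompleteSpace E] in
/-- The area radius is nonnegative. [folklore] -/
lemma areaRadius_nonneg (s : ℝ) : 0 ≤ 𝒩.areaRadius s :=
  Real.sqrt_nonneg _

/-- The **outgoing null expansion** `θ_L = tr_γ χ_L` of the leaf `S_s` at `y`, with respect to the
generator `L = ∂_s` (`nullExpansion`, sign convention (h); the Levi-Civita hypothesis of `g` is
discharged by `hasLeviCivita`). First variation of area: `∂_s dA_s = θ_L dA_s`. Hawking–Ellis 1973,
§4.2; Mars–Soria 2016, §2 (`k(η_S) = θ_k η_S`). [cite: MarsSoria2015, §2] -/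
def expansion (s : ℝ) (y : 𝒩.surf) : ℝ :=
  haveI := g.toPseudoRiemannianMetric.hasLeviCivita
  g.nullExpansion (𝒩.sec s) 𝒩.hpb (𝒩.isSpacelike s) (𝒩.pair s).L y

/-- The **ingoing (transversal) null expansion** `θ_L̲ = tr_γ χ_L̲` of the leaf `S_s` at `y`.
Hawking–Ellis 1973, §4.2; Mars–Soria 2016, §2 (`θ_ℓ`). [cite: MarsSoria2015, §2] -/
def expansionBar (s : ℝ) (y : 𝒩.surf) : ℝ :=
  haveI := g.toPseudoRiemannianMetric.hasLeviCivita
  g.nullExpansion (𝒩.sec s) 𝒩.hpb (𝒩.isSpacelike s) (𝒩.pair s).Lbar y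

/-- The **shear** `χ̂_L` of the generator on the leaf `S_s` at `y` (`nullShear`). Roesch 2016,
Def. 1.1; Alexakis 2015, §2.2 ("expansion and shear of `𝒩`"). [cite: Roesch2016, Def. 1.1] -/
def shear (s : ℝ) (y : 𝒩.surf) : LinearMap.BilinForm ℝ (TangentSpace (𝓡 2) y) :=
  haveI := g.toPseudoRiemannianMetric.hasLeviCivita
  g.nullShear (𝓡 2) (𝒩.sec s) 𝒩.hpb (𝒩.isSpacelike s) (𝒩.pair s).L y

/-- The **transversal shear** `χ̂_L̲` on the leaf `S_s` at `y` (`nullShear` for `L̲`). Roesch 2016,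
Def. 1.1. [cite: Roesch2016, Def. 1.1] -/
def shearBar (s : ℝ) (y : 𝒩.surf) : LinearMap.BilinForm ℝ (TangentSpace (𝓡 2) y) :=
  haveI := g.toPseudoRiemannianMetric.hasLeviCivita
  g.nullShear (𝓡 2) (𝒩.sec s) 𝒩.hpb (𝒩.isSpacelike s) (𝒩.pair s).Lbar y

/-- The squared norm `|χ̂_L|²_γ` of the shear of the generator on `S_s` at `y`: the tree's
`LorentzianMetric.nullShearNormSq` (`BondiNewsFlux.lean`, `|χ̂_L|² = |χ_L|²_γ - ½ θ_L²`, the squared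
`γ`-norm of `nullShear` by the polarisation identity; nonnegative for surfaces,
`nullShearNormSq_nonneg`). Alexakis 2015, Lemma 19; Christodoulou–Klainerman 1993, (17.0.7).
[cite: Alexakis2015, Lemma 19] -/
def shearNormSq (s : ℝ) (y : 𝒩.surf) : ℝ :=
  haveI := g.toPseudoRiemannianMetric.hasLeviCivita
  g.nullShearNormSq (𝒩.sec s) 𝒩.hpb (𝒩.isSpacelike s) (𝒩.pair s).L y

/-- `|χ̂_L|²_γ ≥ 0` on the `2`-dimensional leaves (`nullShearNormSq_nonneg`). [folklore] -/
lemma shearNormSq_nonneg (s : ℝ) (y : 𝒩.surf) : 0 ≤ 𝒩.shearNormSq s y := by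
  haveI := g.toPseudoRiemannianMetric.hasLeviCivita
  exact g.nullShearNormSq_nonneg (𝒩.sec s) 𝒩.hpb (𝒩.isSpacelike s) (𝒩.pair s).L y

/-- The **torsion** `ζ_s(y)`, `ζ(v) = ½ g(D_v L, L̲)`, of the leaf `S_s` with respect to the
adapted pair (`LorentzianMetric.torsion`). Christodoulou 2008, (1.48). [cite: Christodoulou2008, (1.48)] -/
def torsion (s : ℝ) (y : 𝒩.surf) : TangentSpace (𝓡 2) y →ₗ[ℝ] ℝ :=
  haveI := g.toPseudoRiemannianMetric.hasLeviCivita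
  g.torsion (𝒩.sec s) (𝒩.pair s) y

/-- The squared norm `|ζ|²_γ` of the torsion on `S_s` at `y` (`torsionNormSq`). Alexakis 2015,
Lemma 19. [cite: Alexakis2015, Lemma 19] -/
def torsionNormSq (s : ℝ) (y : 𝒩.surf) : ℝ :=
  haveI := g.toPseudoRiemannianMetric.hasLeviCivita
  g.torsionNormSq (𝒩.sec s) 𝒩.hpb (𝒩.isSpacelike s) (𝒩.pair s) y

/-- `|ζ|²_γ ≥ 0`. [folklore] -/
lemma torsionNormSq_nonneg (s : ℝ) (y : 𝒩.surf) : 0 ≤ 𝒩.torsionNormSq s y := by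
  haveI := g.toPseudoRiemannianMetric.hasLeviCivita
  exact g.torsionNormSq_nonneg (𝒩.sec s) 𝒩.hpb (𝒩.isSpacelike s) (𝒩.pair s) y

/-- The **Gauss curvature** `K_s(y)` of the leaf `S_s` (`LorentzianMetric.gaussCurvature`, half the
scalar curvature of `γ_s`). Christodoulou–Klainerman 1993, Ch. 17. [cite: ChristodoulouKlainerman1993PMS41, Ch. 17] -/
def gaussCurvature (s : ℝ) (y : 𝒩.surf) : ℝ :=
  g.gaussCurvature (𝒩.sec s) (𝒩.isSpacelike s) y

/-- The **mass aspect function** `μ_s(y) = K + ¼ θ_L θ_L̲ - div_γ ζ̲` (`= K + ¼ θ_L θ_L̲ + div_γ ζ`)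
of the leaf `S_s` with respect to the adapted pair (`LorentzianMetric.massAspect`, see there for
the dictionary of conventions). Roesch 2016, §1.1; Alexakis 2015, §2.2; Le 2024, Def. 6.1.
[cite: Roesch2016, §1.1 (mass aspect function)] -/
def massAspect (s : ℝ) (y : 𝒩.surf) : ℝ :=
  haveI := g.toPseudoRiemannianMetric.hasLeviCivita
  g.massAspect (𝒩.sec s) 𝒩.hpb (𝒩.isSpacelike s) (𝒩.pair s) y

/-- The **Hawking mass** `m_H(S_s) = √(|S_s|/16π) (1 + (16π)⁻¹ ∫_{S_s} θ_L θ_L̲ dA)` of the leaf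
`S_s` with respect to the adapted pair (`LorentzianMetric.hawkingMass`; boost-invariant, so the same
for every null normal pair of the leaf). Hawking 1968, (3.7); Christodoulou–Klainerman 1993,
(17.0.2). [cite: ChristodoulouKlainerman1993, Ch. 17, (17.0.2)] -/
def hawkingMass (s : ℝ) : ℝ :=
  haveI := g.toPseudoRiemannianMetric.hasLeviCivita
  g.hawkingMass (𝒩.sec s) 𝒩.hpb (𝒩.isSpacelike s) (𝒩.pair s)

/-- The **mean mass aspect** `μ̄_s := (4π / |S_s|) (1 + (16π)⁻¹ ∫_{S_s} θ_L θ_L̲ dA) = 2 m_H(S_s) / r_s³`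
of the leaf `S_s` (`hawkingMass_eq_areaRadius_pow_mul`). For a leaf of spherical topology this is
the average `⨍_{S_s} μ dA` of the mass aspect function, by Gauss–Bonnet (`∫ K = 4π`) and the
divergence theorem (`∫ div ζ̲ = 0`): Alexakis 2015, §2.2 (`∫_𝒮 μ = 8π m_Hawk/r`); Le 2024, Def. 6.2
(`μ̄ᵘ`). Defined through the Hawking mass so that no Gauss–Bonnet theorem is presupposed. Junk
value `0`-division if `|S_s| = 0`. [cite: Alexakis2015, §2.2 (Hawk-MA)] -/
def meanMassAspect (s : ℝ) : ℝ :=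
  4 * π / (𝒩.area s).toReal *
    (1 + (16 * π)⁻¹ * ∫ y, 𝒩.expansion s y * 𝒩.expansionBar s y ∂(𝒩.sectionMeasure s))

/-- The **Hawking flux density** `Φ_s(y)` of the foliated null hypersurface: the leaf density

  `Φ = (r_s / 16π) · ( θ_L (μ̄_s - μ) + θ_L |ζ|²_γ - ½ θ_L̲ |χ̂_L|²_γ - ½ θ_L̲ Ric(L, L) + ½ θ_L G(L, L̲) )`

whose leaf integral is the rate of change of the Hawking mass along the foliation,
`d/ds m_H(S_s) = ∫_{S_s} Φ_s dA_s` (`HasHawkingFlux`; Sauter 2008, Thm. 4.1, as reported by Roesch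
2016, §2.3, and by Alexakis 2015, Lemma 19). Here `θ_L, θ_L̲` are the expansions, `μ` the mass aspect
function and `μ̄_s` its mean (`meanMassAspect`), `ζ` the torsion, `χ̂_L` the shear of the
generator, `Ric` and `G = Ric - ½ R g` the Ricci and Einstein tensors of `g` (`= 8π T(L,L)`,
`8π T(L, L̲)` under the Einstein equations), all for the adapted pair `L = ∂_s`, `g(L, L̲) = -2`.
It is assembled from the first variation of area `∂_s dA = θ_L dA`, the Raychaudhuri equation
`L θ_L = -½ θ_L² - |χ̂_L|² - Ric(L,L) + κ θ_L` and the transport equation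
`L θ_L̲ = G(L, L̲) - 2K - θ_L θ_L̲ - 2 div ζ + 2 |ζ|² - κ θ_L̲` (Mars–Soria 2016, §2, eqs. before
Lemma 1, with `φ = 2`, `s_ℓ = ζ`; Roesch 2016, Prop. 3.1, (11) and (13); Christodoulou 2008,
(2.139)), the `κ`-terms cancelling. Special cases in print (vacuum): luminosity foliations —
Alexakis 2015, Lemma 19 (`dm/ds = (r/32π) ∫ (tr χ |χ̲̂|² + tr χ̲ |ζ|²) dV_s ≥ 0` in his notation:
the shear and torsion terms); constant mass aspect foliations — Le 2024, (6.7):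
`L̄ μ̄ = -(3/2) μ̄ \overline{tr χ̄} + ¼ \overline{tr χ̄' |χ̂̄|²} + ½ \overline{tr χ̄ |η̄|²}` (bars:
leaf means), which is the present identity for `m_H = ½ r³ μ̄` (`hawkingMass_eq_areaRadius_pow_mul`)
under the dictionary `tr χ̄ = θ_L`, `tr χ̄' = -θ_L̲`, `|η̄| = |ζ|`. The only term of indefinite sign
is `θ_L (μ̄ - μ)`: it integrates to zero on spherical leaves when `θ_L` is constant
on the leaf (luminosity foliations, `IsLuminosityFoliation`) and vanishes identically when `μ = μ̄`
(`IsConstantMassAspect`); the others are `≥ 0` when `θ_L > 0 > θ_L̲` (`IsDoublyConvex`) and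
`Ric(L,L) ≥ 0 ≤ G(L,L̲)` (null convergence and dominant energy conditions).
[cite: Alexakis2015, Lemma 19] [cite: MarsSoria2015, §2, Lemma 1] -/
def hawkingFluxDensity (s : ℝ) (y : 𝒩.surf) : ℝ :=
  haveI := g.toPseudoRiemannianMetric.hasLeviCivita
  𝒩.areaRadius s / (16 * π) *
    (𝒩.expansion s y * (𝒩.meanMassAspect s - 𝒩.massAspect s y) +
      𝒩.expansion s y * 𝒩.torsionNormSq s y -
      (1 / 2 : ℝ) * 𝒩.expansionBar s y * 𝒩.shearNormSq s y -
      (1 / 2 : ℝ) * 𝒩.expansionBar s y *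
        g.ricci (𝒩.sec s y) ((𝒩.pair s).L y) ((𝒩.pair s).L y) +
      (1 / 2 : ℝ) * 𝒩.expansion s y *
        g.einsteinTensor (𝒩.sec s y) ((𝒩.pair s).L y) ((𝒩.pair s).Lbar y))

/-- The **Hawking flux** `∫_{S_s} Φ_s dA_s` through the leaf `S_s`: the rate of change of the Hawking
mass along the foliation (`HasHawkingFlux`). Bochner integral w.r.t. the leaf area measure
`sectionMeasure s` (junk value `0` for a non-integrable density). Sauter 2008, Thm. 4.1 (via Roesch
2016, §2.3); Alexakis 2015, Lemma 19. [cite: Alexakis2015, Lemma 19] -/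
def hawkingFlux (s : ℝ) : ℝ :=
  ∫ y, 𝒩.hawkingFluxDensity s y ∂(𝒩.sectionMeasure s)

/-- The foliated null hypersurface **has the Hawking flux identity at `s`**:
`d/ds m_H(S_s) = ∫_{S_s} Φ_s dA_s` (`HasDerivAt`). This holds for every smooth (`C³` suffices)
foliated null hypersurface with compact leaves — Sauter 2008, Thm. 4.1 (Roesch 2016, §2.3; Alexakis
2015, Lemma 19 and its proof; Mars–Soria 2016, Lemma 1 for the companion functional
`M(S, ℓ)`) — but is recorded as a predicate, the differential-geometric inputs (first and second
variation along the generator, Gauss–Bonnet/divergence theorem on the leaves) not being formalised.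
[cite: Alexakis2015, Lemma 19] -/
def HasHawkingFluxAt (𝒩 : g.NullHypersurface τ) (s : ℝ) : Prop :=
  HasDerivAt 𝒩.hawkingMass (𝒩.hawkingFlux s) s

/-- The foliated null hypersurface **has the Hawking flux identity**: `d/ds m_H(S_s) = ∫_{S_s} Φ_s dA_s`
at every `s` (`HasHawkingFluxAt`). Sauter 2008, Thm. 4.1; Alexakis 2015, Lemma 19.
[cite: Alexakis2015, Lemma 19] -/
def HasHawkingFlux (𝒩 : g.NullHypersurface τ) : Prop :=
  ∀ s, 𝒩.HasHawkingFluxAt s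

/-! #### Convexity and gauge conditions on the foliation -/

/-- The foliated null hypersurface is **doubly convex**: on every leaf the generator is expanding
and the transversal null normal contracting, `θ_L > 0 > θ_L̲` (so the mean curvature vector of the
leaves is inward spacelike, `⟨H⃗, H⃗⟩ = -θ_L θ_L̲ > 0`); e.g. the sections of an outgoing null cone
near future null infinity of an asymptotically flat spacetime. One-sided versions in print: Roesch
2016, Def. 1.2 ("`Σ` is expanding along `L̲`": `tr χ̲ > 0` for the generator); Mars–Soria 2016, §2
("past expanding, `θ_{-k} ≥ 0`"). Under this sign condition the shear, torsion and matter terms of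
the Hawking flux density are nonnegative (`hawkingFluxDensity_nonneg`). [cite: Roesch2016, Def. 1.2] -/
def IsDoublyConvex (𝒩 : g.NullHypersurface τ) : Prop :=
  ∀ s y, 0 < 𝒩.expansion s y ∧ 𝒩.expansionBar s y < 0

/-- The foliation is **uniformly area expanding**: on every leaf the expansion `θ_L` of the
generator `L = ∂_s` is constant (`∂_s dA_s = θ_L dA_s` with `θ_L = θ_L(s)`), the gauge in which the
indefinite term `θ_L (μ̄ - μ)` of the Hawking flux density integrates to zero over spherical leaves.
Hawking 1968; Roesch 2016, Def. 1.3 ("uniformly area expanding", `ḋA = dA`); Bray–Jauregui–Mars.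
[cite: Roesch2016, Def. 1.3] -/
def IsUniformlyExpanding (𝒩 : g.NullHypersurface τ) : Prop :=
  ∀ s y y', 𝒩.expansion s y = 𝒩.expansion s y'

/-- The foliation is a **luminosity (areal) foliation**: `θ_L ≡ 2 / s` on the leaf `S_s` for
`s > 0`, i.e. the parameter is a luminosity parameter (Hawking 1968; Alexakis 2015, Def. 18:
"`L̲ s = 1`, `tr χ̲^{L̲}[𝒮_s] = 2/s`", `s ∈ [1, ∞)`); then `|S_s| ∝ s²` and `θ_L` is constant on
the leaves (`IsLuminosityFoliation.expansion_eq`). Le 2024, Def. 6.2, uses the equivalent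
area-radius normalisation `r_u = r_{u₀} + u - u₀`, `θ̄_L = 2 / r_u`, for constant mass aspect
foliations. [cite: Alexakis2015, Def. 18] -/
def IsLuminosityFoliation (𝒩 : g.NullHypersurface τ) : Prop :=
  ∀ s, 0 < s → ∀ y, 𝒩.expansion s y = 2 / s

/-- The foliation is a **constant mass aspect (function) foliation**: on every leaf the mass aspect
function equals its mean, `μ = μ̄_s` (Le 2024, Def. 6.2: "`ᵘμ̄ = \overline{ᵘμ̄}`"; introduced in
Christodoulou–Klainerman 1993 and, on null cones, in Sauter 2008, where it renders the Hawking mass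
monotone: the indefinite term of the Hawking flux density vanishes identically). [cite: Le2024, Def. 6.2] -/
def IsConstantMassAspect (𝒩 : g.NullHypersurface τ) : Prop :=
  ∀ s y, 𝒩.massAspect s y = 𝒩.meanMassAspect s

variable {𝒩}

/-- On a luminosity foliation the expansion of the generator is constant on each leaf `S_s`,
`s > 0`. Alexakis 2015, Def. 18. [cite: Alexakis2015, Def. 18] -/
lemma IsLuminosityFoliation.expansion_eq (h : 𝒩.IsLuminosityFoliation) {s : ℝ} (hs : 0 < s)
    (y y' : 𝒩.surf) : 𝒩.expansion s y = 𝒩.expansion s y' := by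
  rw [h s hs y, h s hs y']

/-- **Hawking mass in terms of the mean mass aspect**: `m_H(S_s) = ½ r_s³ μ̄_s` whenever the leaf has
positive (finite) area (`r_s = √(|S_s|/4π)`). Alexakis 2015, §2.2 (`∫_𝒮 μ = 8π m_Hawk / r`);
Christodoulou–Klainerman 1993, Ch. 17. [cite: Alexakis2015, §2.2 (Hawk-MA)] -/
theorem hawkingMass_eq_areaRadius_pow_mul (s : ℝ) (hA : 0 < (𝒩.area s).toReal) :
    𝒩.hawkingMass s = (1 / 2 : ℝ) * 𝒩.areaRadius s ^ 3 * 𝒩.meanMassAspect s := by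
  set A : ℝ := (𝒩.area s).toReal with hAdef
  set J : ℝ := ∫ y, 𝒩.expansion s y * 𝒩.expansionBar s y ∂(𝒩.sectionMeasure s) with hJ
  have hm : 𝒩.hawkingMass s = √(A / (16 * π)) * (1 + (16 * π)⁻¹ * J) := rfl
  have hμ : 𝒩.meanMassAspect s = 4 * π / A * (1 + (16 * π)⁻¹ * J) := rfl
  have hr : 𝒩.areaRadius s = √(A / (4 * π)) := rfl
  have hπ : 0 < 4 * π := by positivity
  have hx : 0 ≤ A / (4 * π) := by positivity
  have h16 : √(A / (16 * π)) = √(A / (4 * π)) / 2 := by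
    rw [show A / (16 * π) = A / (4 * π) / 4 by ring, Real.sqrt_div' _ (by norm_num : (0:ℝ) ≤ 4),
      show √(4 : ℝ) = 2 by
        rw [show (4 : ℝ) = 2 ^ 2 by norm_num, Real.sqrt_sq (by norm_num : (0:ℝ) ≤ 2)]]
  have hcube : √(A / (4 * π)) ^ 3 * (4 * π / A) = √(A / (4 * π)) := by
    have hsq : √(A / (4 * π)) ^ 2 = A / (4 * π) := Real.sq_sqrt hx
    have hA0 : A ≠ 0 := hA.ne'
    calc √(A / (4 * π)) ^ 3 * (4 * π / A)
        = √(A / (4 * π)) * (√(A / (4 * π)) ^ 2 * (4 * π / A)) := by ring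
      _ = √(A / (4 * π)) := by rw [hsq]; field_simp
  rw [hm, hμ, hr, h16]
  calc √(A / (4 * π)) / 2 * (1 + (16 * π)⁻¹ * J)
      = 1 / 2 * (√(A / (4 * π)) ^ 3 * (4 * π / A)) * (1 + (16 * π)⁻¹ * J) := by rw [hcube]; ring
    _ = 1 / 2 * √(A / (4 * π)) ^ 3 * (4 * π / A * (1 + (16 * π)⁻¹ * J)) := by ring

/-- **Sign of the Hawking flux density.** At a point of a leaf where the mass aspect function takes
its mean value (`μ = μ̄_s`, e.g. everywhere on a constant mass aspect foliation), where the leaf is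
doubly convex (`θ_L > 0 > θ_L̲`) and the spacetime satisfies the null convergence condition
`Ric(L, L) ≥ 0` and `G(L, L̲) ≥ 0` (dominant energy condition via the Einstein equations), the
Hawking flux density is nonnegative. This is the pointwise content of the monotonicity of the
Hawking mass along such foliations (Sauter 2008, §4; Alexakis 2015, Lemma 19: "when
`tr χ ≥ 0` and `tr χ̲ ≥ 0` … `m_Hawk[𝒮_s]` is non-decreasing"). [cite: Alexakis2015, Lemma 19] -/
theorem hawkingFluxDensity_nonneg {s : ℝ} {y : 𝒩.surf}
    (hμ : 𝒩.massAspect s y = 𝒩.meanMassAspect s)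
    (hθ : 0 < 𝒩.expansion s y) (hθ' : 𝒩.expansionBar s y < 0)
    (hRic : haveI := g.toPseudoRiemannianMetric.hasLeviCivita
      0 ≤ g.ricci (𝒩.sec s y) ((𝒩.pair s).L y) ((𝒩.pair s).L y))
    (hG : haveI := g.toPseudoRiemannianMetric.hasLeviCivita
      0 ≤ g.einsteinTensor (𝒩.sec s y) ((𝒩.pair s).L y) ((𝒩.pair s).Lbar y)) :
    0 ≤ 𝒩.hawkingFluxDensity s y := by
  have hr : 0 ≤ 𝒩.areaRadius s / (16 * π) := by
    have := 𝒩.areaRadius_nonneg s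
    positivity
  have hζ := 𝒩.torsionNormSq_nonneg s y
  have hshear := 𝒩.shearNormSq_nonneg s y
  unfold hawkingFluxDensity
  refine mul_nonneg hr ?_
  rw [hμ, sub_self, mul_zero, zero_add]
  have h1 : 0 ≤ 𝒩.expansion s y * 𝒩.torsionNormSq s y := mul_nonneg hθ.le hζ
  have h2 : 0 ≤ -(1 / 2 : ℝ) * 𝒩.expansionBar s y * 𝒩.shearNormSq s y :=
    mul_nonneg (by linarith) hshear
  have h3 : 0 ≤ -(1 / 2 : ℝ) * 𝒩.expansionBar s y * _ := mul_nonneg (by linarith) hRic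
  have h4 : 0 ≤ (1 / 2 : ℝ) * 𝒩.expansion s y * _ := mul_nonneg (by linarith) hG
  linarith

/-- A nonnegative flux density gives a nonnegative Hawking flux through the leaf. [folklore] -/
theorem hawkingFlux_nonneg {s : ℝ} (h : ∀ y, 0 ≤ 𝒩.hawkingFluxDensity s y) :
    0 ≤ 𝒩.hawkingFlux s :=
  integral_nonneg h

/-- **Monotonicity of the Hawking mass from the flux identity**: if the Hawking flux identity holds
along the foliated null hypersurface and the flux density is everywhere nonnegative, the Hawking
mass of the leaves is a non-decreasing function of the parameter. Hawking 1968; Sauter 2008, §4;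
Alexakis 2015, Lemma 19. [cite: Alexakis2015, Lemma 19] -/
theorem hawkingMass_monotone (hflux : 𝒩.HasHawkingFlux)
    (h : ∀ s y, 0 ≤ 𝒩.hawkingFluxDensity s y) : Monotone 𝒩.hawkingMass :=
  monotone_of_deriv_nonneg (fun s ↦ (hflux s).differentiableAt) fun s ↦ by
    rw [(hflux s).deriv]
    exact hawkingFlux_nonneg (h s)

/-! #### Roesch's flux function, quasi-local mass and (P)-foliations -/

variable (𝒩)

/-- The **leaf Laplacian** `Δ_γ f (y) = tr_γ Hess_γ f` of a function on the leaf `S_s` (the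
Laplace–Beltrami operator of the induced Riemannian metric `γ_s`, `dalembertian` of `leafMetric`;
O'Neill 1983, Ch. 3, Def. 3.50, `Δ f = div grad f = C(H^f)`). [cite: ONeill1983, Ch. 3, Def. 3.50] -/
def leafLaplacian (s : ℝ) (f : 𝒩.surf → ℝ) (y : 𝒩.surf) : ℝ :=
  haveI := (𝒩.leafMetric s).hasLeviCivita
  (𝒩.leafMetric s).dalembertian f y

/-- **Roesch's geometric flux function** `ρ` of the leaf `S_s` at `y` (defined where the generator is
expanding, `θ_L > 0`): with the *null inflation basis* `(L⁻, L⁺) = (L / θ_L, θ_L L')`, `L' = -L̲`,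
of Roesch 2016, Def. 1.3 (the rescaling of the generator with unit expansion, `tr χ⁻ = 1`) and its
torsion `τ(V) = ½ ⟨D_V L⁻, L⁺⟩ = ζ̲(V) - V log θ_L` (ibid., after Def. 1.3),

  `ρ = 𝒦 - ¼ ⟨H⃗, H⃗⟩ + ∇̸ · τ = K + ¼ θ_L θ_L̲ + div_γ ζ̲ - Δ_γ log θ_L`

(Roesch 2016, Def. 1.4, (1); in the present normalisation `⟨H⃗, H⃗⟩ = -θ_L θ_L̲` and Roesch's
torsion `ζ` is `ζ̲ = torsion (pair s).swap`, see `LorentzianMetric.torsion`). It is invariant under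
boosts of the null frame and satisfies `∫_Σ ρ dA = 8π E_H(Σ) / √(|Σ|/4π)` on spheres (ibid., §1.1).
[cite: Roesch2016, Def. 1.4] -/
def roeschFlux (s : ℝ) (y : 𝒩.surf) : ℝ :=
  haveI := g.toPseudoRiemannianMetric.hasLeviCivita
  haveI := (𝒩.leafMetric s).hasLeviCivita
  𝒩.gaussCurvature s y + (1 / 4 : ℝ) * (𝒩.expansion s y * 𝒩.expansionBar s y) +
      (𝒩.leafMetric s).divCovector (g.torsion (𝒩.sec s) (𝒩.pair s).swap) y -
    𝒩.leafLaplacian s (fun y' ↦ Real.log (𝒩.expansion s y')) y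

/-- **Roesch's quasi-local mass** `m(Σ_s) = ½ ((4π)⁻¹ ∫_{Σ_s} ρ^{2/3} dA)^{3/2}` of the leaf `S_s`
(Roesch 2016, Def. 1.4, (2); meant for `ρ > 0`, real powers `Real.rpow` otherwise giving junk
values). On every spherical cross-section of the standard Schwarzschild null cone of mass `M`,
`m(Σ) = M` (ibid., §2.2); `m` is non-decreasing along (P)-foliations of null cones in spacetimes
satisfying the null energy condition (ibid., Thms. 1.1–1.2). [cite: Roesch2016, Def. 1.4] -/
def roeschMass (s : ℝ) : ℝ :=
  (1 / 2 : ℝ) *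
    ((4 * π)⁻¹ * ∫ y, 𝒩.roeschFlux s y ^ (2 / 3 : ℝ) ∂(𝒩.sectionMeasure s)) ^ (3 / 2 : ℝ)

/-- The foliation is a **(P)-foliation** (Roesch 2016, Def. 1.5): on every leaf

  `ρ > 0`  and  `¼ ⟨H⃗, H⃗⟩ ≥ Δ̸ log ρ^{1/3}`,  i.e.  `-¼ θ_L θ_L̲ ≥ Δ_γ log (ρ^{1/3})`,

the convexity condition under which, in a spacetime satisfying the null energy condition, Roesch's
mass `m(Σ_s)` (`roeschMass`) is non-decreasing along the foliation (ibid., Thm. 1.1 and the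
discussion after Def. 1.5) and the null Penrose inequality follows on past asymptotically flat null
cones (ibid., Thm. 1.2). [cite: Roesch2016, Def. 1.5] -/
def IsPFoliation (𝒩 : g.NullHypersurface τ) : Prop :=
  ∀ s y, 0 < 𝒩.roeschFlux s y ∧
    𝒩.leafLaplacian s (fun y' ↦ Real.log (𝒩.roeschFlux s y' ^ (1 / 3 : ℝ))) y ≤
      -(1 / 4 : ℝ) * (𝒩.expansion s y * 𝒩.expansionBar s y)

/-- The foliation is a **strict (P)-foliation ((SP)-foliation)** for the initial leaf `s₀` (Roesch
2016, Def. 1.5): a (P)-foliation with equality `¼⟨H⃗,H⃗⟩ = Δ̸ log ρ^{1/3}` on `Σ_{s₀}` and strict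
inequality on the later leaves `s > s₀` (Roesch takes `s₀ = 0`). [cite: Roesch2016, Def. 1.5] -/
def IsSPFoliation (𝒩 : g.NullHypersurface τ) (s₀ : ℝ) : Prop :=
  𝒩.IsPFoliation ∧
    (∀ y, 𝒩.leafLaplacian s₀ (fun y' ↦ Real.log (𝒩.roeschFlux s₀ y' ^ (1 / 3 : ℝ))) y =
      -(1 / 4 : ℝ) * (𝒩.expansion s₀ y * 𝒩.expansionBar s₀ y)) ∧
    ∀ s, s₀ < s → ∀ y,
      𝒩.leafLaplacian s (fun y' ↦ Real.log (𝒩.roeschFlux s y' ^ (1 / 3 : ℝ))) y <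
        -(1 / 4 : ℝ) * (𝒩.expansion s y * 𝒩.expansionBar s y)

variable {𝒩}

/-- An (SP)-foliation is a (P)-foliation. Roesch 2016, Def. 1.5. [cite: Roesch2016, Def. 1.5] -/
lemma IsSPFoliation.isPFoliation {s₀ : ℝ} (h : 𝒩.IsSPFoliation s₀) : 𝒩.IsPFoliation :=
  h.1

/-- On a (P)-foliation Roesch's flux function is positive. Roesch 2016, Def. 1.5. [cite: Roesch2016, Def. 1.5] -/
lemma IsPFoliation.roeschFlux_pos (h : 𝒩.IsPFoliation) (s : ℝ) (y : 𝒩.surf) :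
    0 < 𝒩.roeschFlux s y :=
  (h s y).1

end NullHypersurface

/-! #### The cones of a Bondi foliation as foliated null hypersurfaces -/

namespace BondiFoliation

variable {g : LorentzianMetric I ∞ M} {τ : TimeOrientation g} {X : Type*} [TopologicalSpace X]
  {ι : X → M} (𝓕 : g.BondiFoliation τ ι)

/-- The cone `C⁺_u` of the Bondi foliation `𝓕`, with its sections `s ↦ sec u s` and null normal
pairs `pair u s`, is an **adapted foliated null hypersurface**: the sections sweep the cone
injectively, depend differentiably on `s`, and the outgoing null normal `L` *is* the generator
`∂_s sec u s` (unit null lapse). `BondiFoliation` itself records no relation between the sections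
for different `s`; this is the extra regularity under which the leafwise null geometry and the
Hawking flux of `NullHypersurface` apply to the cone (`coneNullHypersurface`). Christodoulou–
Klainerman 1993, Ch. 17 (the foliation of `C_u` by the `S_{t,u}`). [folklore] -/
def IsAdaptedCone (𝓕 : g.BondiFoliation τ ι) (u : ℝ) : Prop :=
  Function.Injective (Function.uncurry (𝓕.sec u)) ∧
    (∀ y, MDifferentiable 𝓘(ℝ, ℝ) I (fun s ↦ 𝓕.sec u s y)) ∧
      ∀ s y, (𝓕.pair u s).L y = velocity I (fun s' ↦ 𝓕.sec u s' y) s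

variable {𝓕}

/-- The cone `C⁺_u` of a Bondi foliation, when adapted (`IsAdaptedCone`), as a foliated null
hypersurface with adapted null normal pair: sections `sec u`, pairs `pair u`; nullity, time
orientation and orthogonality of the generator are those of `L = ∂_s sec`. [folklore] -/
def coneNullHypersurface {u : ℝ} (h : 𝓕.IsAdaptedCone u) : g.NullHypersurface τ where
  surf := 𝓕.surf
  hpb := 𝓕.hpb
  sec := 𝓕.sec u
  injective := h.1
  isSmoothEmbedding := 𝓕.isSmoothEmbedding u
  isSpacelike := 𝓕.isSpacelike u
  mdifferentiable := h.2.1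
  isNull s y := by
    rw [← h.2.2 s y]
    exact (𝓕.pair u s).isNull_L y
  isFutureDirected s y := by
    rw [← h.2.2 s y]
    exact (𝓕.pair u s).isFutureDirected_L y
  isNormalTo s := by
    have hfun : (fun y ↦ velocity I (fun s' ↦ 𝓕.sec u s' y) s) = (𝓕.pair u s).L :=
      funext fun y ↦ (h.2.2 s y).symm
    rw [hfun]
    exact (𝓕.pair u s).isNormalTo_L
  pair := 𝓕.pair u
  pair_L := h.2.2

omit [CompleteSpace E] in
/-- The leaves of the cone are the sections of the Bondi foliation. [folklore] -/
@[simp]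
lemma coneNullHypersurface_sec {u : ℝ} (h : 𝓕.IsAdaptedCone u) :
    (coneNullHypersurface h).sec = 𝓕.sec u :=
  rfl

/-- The Hawking mass of the leaves of the adapted cone `C⁺_u` is the section Hawking mass
`m_H(S_{u,s})` of the Bondi foliation (whose limit `s → ∞` is the Bondi mass `M_B(u)`), so that the
Hawking flux identity along the cone reads `d/ds m_H(S_{u,s}) = ∫_{S_{u,s}} Φ dA`.
Christodoulou–Klainerman 1993, Ch. 17, Conclusion 17.0.4. [cite: ChristodoulouKlainerman1993PMS41, Ch. 17, Conclusion 17.0.4] -/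
lemma coneNullHypersurface_hawkingMass {u : ℝ} (h : 𝓕.IsAdaptedCone u) (s : ℝ) :
    (coneNullHypersurface h).hawkingMass s = 𝓕.sectionHawkingMass u s :=
  rfl

end BondiFoliation

end Sheet

end LorentzianMetric

end Literature.Geometry.Lorentzian

end
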